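import Literature.AlgebraicGeometry.Frobenioids.PiNatFactorization
import Literature.AlgebraicGeometry.Frobenioids.PerfFactorialWeak
import Literature.AlgebraicGeometry.Frobenioids.PerfFactorialProductCounterexample
import HarnessLib

/-!
# [FrdI] Def. 2.4 (i), repaired form: `∏_J ℤ≥0` IS weakly perf-factorial (and `∏_ℕ ℤ≥0` is not
# perf-factorial) — the positive instance for finding F-L2d2-1

Mochizuki, *The geometry of Frobenioids I*, Kyushu J. Math. **62** (2008), Def. 2.4 (i), kurims p.47
[cite: MochizukiFrdI2008, Def. 2.4(i) p.47]; Mochizuki, *The étale theta function …*, Publ. RIMS **45**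
(2009), Prop. 3.2 (i) PDF p.70 / Prop. 3.4 (i) PDF p.74 [cite: MochizukiEtTh2009, Prop 3.4 p.74]
("`Φ₀(Y^log)` … is perf-factorial").

abc-iut cell, finding F-L2d2-1 / errata register E-14 (seat abc-iut-L2-d2): for a tempered covering with
INFINITELY many special-fibre components, `Φ₀ ⊇ ∏_J ℤ≥0` violates clause (d) of Def. 2.4 (i) (kernel
witness `PerfFactorialProductCounterexample.not_isPerfFactorial_multiplicative_pi_nat`).  The repair adopted
by the cell (abc-iut-L1-t2, `PerfFactorialWeak.lean`) replaces (d) by its two consequences (d_ord), (d_res)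
actually used in [FrdI] §2–§4 / [EtTh] §3.  THIS FILE closes the loop: **`∏_J ℤ≥0 = Multiplicative (J → ℕ)`
is weakly perf-factorial for every index type `J`** (`PiNat.isPerfFactorialWeak`, assembled from
`PiNatMonoid.lean` / `PiNatFactorization.lean`: (a) divisorial, (b) monoprime components, (c) the
factorization homomorphism computed coordinatewise, (d_ord), (d_res)), so the repaired hypothesis is
SATISFIED by the intended model of `DIV⁺(Z_∞^log)`, while the printed one is not
(`PerfFactorialProductCounterexample.not_isPerfFactorial_multiplicative_pi_nat`,
p413961).  HONEST FRAMING: classical monoid algebra about a definition;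
nothing here bears on [IUTchIII] Cor. 3.12.
-/

namespace Literature.AlgebraicGeometry.Frobenioids

namespace PiNat

open Function

universe u

variable {J : Type u} [DecidableEq J]

/-- **`∏_J ℤ≥0` is weakly perf-factorial** (Def. 2.4 (i) with (d) replaced by (d_ord) + (d_res)), for every
index type `J`. [cite: MochizukiFrdI2008, Def. 2.4(i) p.47] -/
theorem isPerfFactorialWeak : IsPerfFactorialWeak (Multiplicative (J → ℕ)) where
  isDivisorial := isDivisorial
  isMonoprime := isMonoprime_submonoid_prime
  bounded := bounded
  factorMap_one := factorMap_one
  factorMap_mul := factorMap_mul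
  factorMap_injective := factorMap_injective
  factorMap_mem_range := factorMap_mem_range
  dvd_of_factorMap_mul_eq' a b x he :=
    dvd_of_factorMap_dvd fun 𝔮 => ⟨pfFactorToRlfFactor _ x 𝔮, by rw [← he, Pi.mul_apply]⟩
  exists_restrict b S := by
    classical
    obtain ⟨z, hz⟩ := exists_factorMap_restrict b S
    exact ⟨z, fun 𝔮 => ⟨fun hS => by rw [hz, if_pos hS], fun hS => by rw [hz, if_neg hS]⟩⟩

omit [DecidableEq J] in
/-- The same without a chosen `DecidableEq J` instance (the statement does not mention coordinates).
[cite: MochizukiFrdI2008, Def. 2.4(i) p.47] -/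
theorem isPerfFactorialWeak' : IsPerfFactorialWeak (Multiplicative (J → ℕ)) := by
  classical
  exact isPerfFactorialWeak

/-- Hence **the repaired notion is strictly weaker than the printed one**: `IsPerfFactorialWeak M` does not
imply `IsPerfFactorial M` (witness `M = ∏_ℕ ℤ≥0`, which is NOT perf-factorial as printed:
`PerfFactorialProductCounterexample.not_isPerfFactorial_multiplicative_pi_nat`, F-L2d2-1).
[cite: MochizukiFrdI2008, Def. 2.4(i) p.47] -/
theorem not_forall_isPerfFactorialWeak_imp_isPerfFactorial :
    ¬ ∀ (M : Type) [CommMonoid M], IsPerfFactorialWeak M → IsPerfFactorial M := fun h =>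
  PerfFactorialProductCounterexample.not_isPerfFactorial_multiplicative_pi_nat
    (h (Multiplicative (ℕ → ℕ)) isPerfFactorialWeak')

end PiNat

end Literature.AlgebraicGeometry.Frobenioids
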